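import Literature.NumberTheory.GaloisRepresentations.CentralInvolutionLayerProofs
import Literature.NumberTheory.GaloisRepresentations.HerbrandTheoremProofs
import Literature.NumberTheory.GaloisRepresentations.TameInertiaProofs
import HarnessLib

/-!
# Squares in the lower ramification filtration in residue characteristic `2`
# (Serre, *Local Fields*, Ch. IV §2, Exercise 3, case `p = 2`)

`Proofs` file (theorems only, no definitions, no named facts) in topic
`NumberTheory/GaloisRepresentations`, landed by the seat of
`WeierstrassCurve.conductorNatOf_geomPoints_eq_conductorNorm_of_isElliptic` (Ogg–Saito at `2` over
`ℚ`) as a generic brick for the Galois side of Ogg's formula above `2`: there the wild conductor of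
`E[3]` is `2φ(b)` with `b + 1 = i_G(ι)` the index of the central involution `ι = σ²` of the
`3`-division field (`ThreeTorsionCentralInvolutionSwanProofs`), and `b` is bounded below from the
index of an element `σ` of order `4` by (a) below, above by (c).

Setting (as in `CentralInvolutionBreakProofs` §2): a Dedekind domain `B` acted on by a group `G`,
a maximal ideal `P ≠ 0` with finite residue field, `G_i = P.ramificationSubgroup G i`,
`2 ∈ P^e` (`e = v_P(2)` when also `2 ∉ P^{e+1}`).  For `σ ∈ G₀` and a uniformiser `π`,
`σ²π - π = 2(σπ - π) + (σ(σπ - π) - (σπ - π))` (`sq_smul_sub_eq`), and `σ ∈ G_i` acts trivially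
on `P^{i+1}/P^{2i+1}` (`smul_sub_mem_pow_add_of_mem_pow`).  Hence:

* `sq_mem_ramificationSubgroup_min` — **(a) `σ ∈ G_i ⇒ σ² ∈ G_{min(2i, i+e)}`**;
* `sq_mem_and_sq_notMem_ramificationSubgroup_of_lt` — **(b) for `i > e = v_P(2)`:
  `σ ∈ G_i ∖ G_{i+1} ⇒ σ² ∈ G_{i+e} ∖ G_{i+e+1}`**;
* `ramificationSubgroup_eq_bot_of_ord_two_lt` — **(c) `G_i = 1` for every `i > e = v_P(2) ≥ 1`**
  (finite faithful action): `G₁` is a `2`-group (`Ideal.isPGroup_ramificationSubgroup_one`,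
  Serre IV §2 Cor. 3) and by (b) no power `σ^{2^k}` of a `σ ∈ G_i ∖ G_{i+1}`, `i > e`, is trivial;
  `lowerIndex_le_of_ord_two` — so `i_G(ι) ≤ e + 1` for every `ι ≠ 1`;
* through a quotient `π : Gal(L/K) → Gal(E/K)` with kernel `{1, z}` (the setting of
  `CentralInvolutionQuotientProofs`: `R` Dedekind, `L/K` finite Galois, `E/K` normal):
  `two_mul_lowerIndex_restrictNormalHom_eq` — **Serre's Prop. IV.3 `2 i_Q(s|_E) = i_G(s) + i_G(sz)`**
  (`IndexFormula_holds` with `e' = #{1, z} = 2`);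
  `lowerIndex_eq_lowerIndex_restrictNormalHom_of_sq_eq` — **`i_G(σ) = i_Q(σ|_E)` for a square
  root `σ ∉ {1, ι}` of `z = ι`** (`σι = σ⁻¹`); `mem_ramificationSubgroup_six_of_sq_eq` — **`ι ∈ G₆`
  as soon as `σ|_E ∈ Q₃` and `2 ∈ 𝔓³`** (then `σ ∈ G₃`, apply (a)); and
  `lowerIndex_add_eq_of_biquadratic` — **the indices of a four-group `{1, z₁, z₂, z₁z₂} ⊆ G₀` from
  its three quadratic quotients**: `i(z₁) + n₁ = n₂ + n₃` etc., where `n_j` is the index of the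
  non-trivial restriction to the fixed field of `z_j` (so the filtration of a biquadratic
  extension at a totally ramified prime is read off the breaks of its quadratic subextensions,
  e.g. breaks `(1, 2, 2)` give `#G₂ = #G₃ = 2`, `#G₄ = 1`).

For the `3`-division field `L = K(E[3])` of an elliptic curve above `2`, `E = K(x(E[3]))`,
`ι = [-1]`: every element of `Gal(L/K)` outside `{1, ι}` whose restriction to `E` lies in the
wild inertia group squares to `ι`, so an element of index `4` in `Gal(E/K)` forces `b ≥ 6` for
the break `b = i_G(ι) - 1`, while (c) gives `b ≤ v_{𝔓_L}(2)`.

These are the case `p = 2` of Serre's Exercise 3 of Ch. IV §2 (`s ∈ G_i ⇒ s^p ∈ G_{pi}`, resp.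
`∈ G_{i+e_L} ∖ G_{i+e_L+1}` for `i > e_L/(p-1)`, whence `G_i = 1` for `i > e_L/(p-1)`), proved by
the uniformiser criterion (Serre IV §1 Lemma 1, §2 Prop. 5; Marcus Ch. 4 Ex. 20,
`mem_ramificationSubgroup_iff_smul_sub_mem`).

## References

* J.-P. Serre, *Local Fields*, GTM 67 (1979), Ch. IV §1 (Lemma 1, `i_G`, Prop. 2–3), §2 (Prop. 5,
  Cor. 1 and Cor. 3 of Prop. 7, Exercise 3, p. 71). [SerreLocalFields1979]
* D. A. Marcus, *Number Fields*, 2nd ed. (2018), Ch. 4, Exercises 20–21. [Marcus2018]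

## Design

Theorems only, in `namespace Literature.NumberTheory.GaloisRepresentations`: §1 in the abstract
setting `(B, P, G)` (`e` enters through the hypotheses `2 ∈ P^e`, `2 ∉ P^{e+1}`), §2 in the
Galois setting `(R, K, L, E)` of `CentralInvolutionQuotientProofs`.  Axioms: `propext`,
`Classical.choice`, `Quot.sound`.
-/

open scoped Pointwise

namespace Literature.NumberTheory.GaloisRepresentations

variable {B : Type*} [CommRing B] [IsDedekindDomain B] {P : Ideal B} [P.IsMaximal]
  {G : Type*} [Group G] [MulSemiringAction G B] [Finite (B ⧸ P)]

omit [IsDedekindDomain B] in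
/-- `σ²π - π = 2(σπ - π) + (σ(σπ - π) - (σπ - π))`. [folklore] -/
theorem sq_smul_sub_eq (σ : G) (π : B) :
    σ ^ 2 • π - π = 2 * (σ • π - π) + (σ • (σ • π - π) - (σ • π - π)) := by
  rw [pow_two, mul_smul, smul_sub]
  ring

/-- **The square of an element of `G_i` lies in `G_{min(2i, i+e)}`** (`2 ∈ P^e`).  Let `B` be a
Dedekind domain acted on by `G`, `P ≠ 0` a maximal ideal with finite residue field, `σ ∈ G₀`
with `σ ∈ G_i`, and `2 ∈ P ^ e`.  Then `σ² ∈ G_{min(2i, i + e)}`: for a uniformiser `π`,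
`a = σπ - π ∈ P^{i+1}`, and `σ²π - π = 2a + (σa - a)` with `2a ∈ P^{e+i+1}` and
`σa - a ∈ P^{2i+1}` (`σ` acts trivially on `P^{i+1}/P^{2i+1}`, `smul_sub_mem_pow_add_of_mem_pow`);
conclude by the uniformiser criterion (Serre IV §1 Lemma 1 / Marcus Ch. 4 Ex. 20).  This is the
case `p = 2` of Serre's Exercise IV.3(a) (`s ∈ G_i ⇒ s^p ∈ G_{pi}` resp. `G_{i+e}`).
[cite: SerreLocalFields1979, Ch. IV §2 Exercise 3 (a) (p. 71) and §1 Lemma 1] -/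
theorem sq_mem_ramificationSubgroup_min (hP : P ≠ ⊥) {σ : G}
    (hσ0 : σ ∈ P.ramificationSubgroup G 0) {i : ℕ} (hσ : σ ∈ P.ramificationSubgroup G i)
    {e : ℕ} (h2 : (2 : B) ∈ P ^ e) :
    σ ^ 2 ∈ P.ramificationSubgroup G (min (2 * i) (i + e)) := by
  have hPtop : P ≠ ⊤ := Ideal.IsMaximal.ne_top inferInstance
  obtain ⟨ϖ, hϖ, hϖ2⟩ := Ideal.exists_mem_pow_notMem_pow_succ P hP hPtop 1
  rw [pow_one] at hϖ
  have hsq0 : σ ^ 2 ∈ P.ramificationSubgroup G 0 := Subgroup.pow_mem _ hσ0 2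
  rw [mem_ramificationSubgroup_iff_smul_sub_mem hP hϖ hϖ2 hsq0, sq_smul_sub_eq]
  have ha : σ • ϖ - ϖ ∈ P ^ (i + 1) := (mem_ramificationSubgroup_iff_smul_sub_mem hP hϖ hϖ2 hσ0 i).mp hσ
  refine Ideal.add_mem _ ?_ ?_
  · have h := Ideal.mul_mem_mul h2 ha
    rw [← pow_add] at h
    exact Ideal.pow_le_pow_right (by omega) h
  · have h := smul_sub_mem_pow_add_of_mem_pow hσ ha
    exact Ideal.pow_le_pow_right (by omega) h

/-- **Exact form above the threshold `i > e = v_P(2)`**: if `σ ∈ G₀`, `σ ∈ G_i ∖ G_{i+1}` with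
`e < i`, `2 ∈ P^e ∖ P^{e+1}`, then `σ² ∈ G_{i+e} ∖ G_{i+e+1}`: in `σ²π - π = 2a + (σa - a)` the
first term has order exactly `e + i + 1 < 2i + 1 ≤ v(σa - a)`.  Serre's Exercise IV.3(b)
(`s ∈ G_i ∖ G_{i+1}`, `i > e_L/(p-1)` ⇒ `s^p ∈ G_{i+e_L} ∖ G_{i+e_L+1}`) for `p = 2`.
[cite: SerreLocalFields1979, Ch. IV §2 Exercise 3 (b) (p. 71)] -/
theorem sq_mem_and_sq_notMem_ramificationSubgroup_of_lt (hP : P ≠ ⊥) {σ : G}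
    (hσ0 : σ ∈ P.ramificationSubgroup G 0) {i : ℕ} (hσ : σ ∈ P.ramificationSubgroup G i)
    (hσ' : σ ∉ P.ramificationSubgroup G (i + 1)) {e : ℕ} (h2 : (2 : B) ∈ P ^ e)
    (h2' : (2 : B) ∉ P ^ (e + 1)) (hei : e < i) :
    σ ^ 2 ∈ P.ramificationSubgroup G (i + e) ∧ σ ^ 2 ∉ P.ramificationSubgroup G (i + e + 1) := by
  have hPtop : P ≠ ⊤ := Ideal.IsMaximal.ne_top inferInstance
  obtain ⟨ϖ, hϖ, hϖ2⟩ := Ideal.exists_mem_pow_notMem_pow_succ P hP hPtop 1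
  rw [pow_one] at hϖ
  have hsq0 : σ ^ 2 ∈ P.ramificationSubgroup G 0 := Subgroup.pow_mem _ hσ0 2
  have ha : σ • ϖ - ϖ ∈ P ^ (i + 1) :=
    (mem_ramificationSubgroup_iff_smul_sub_mem hP hϖ hϖ2 hσ0 i).mp hσ
  have ha' : σ • ϖ - ϖ ∉ P ^ (i + 2) := fun h ↦
    hσ' ((mem_ramificationSubgroup_iff_smul_sub_mem hP hϖ hϖ2 hσ0 (i + 1)).mpr h)
  -- orders
  have horda : ord P (σ • ϖ - ϖ) = ((i + 1 : ℕ) : ℕ∞) := by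
    refine le_antisymm ?_ ((mem_pow_iff_le_ord P).mp ha)
    by_contra hlt
    push Not at hlt
    apply ha'
    rw [mem_pow_iff_le_ord]
    have : ((i + 1 : ℕ) : ℕ∞) + 1 ≤ ord P (σ • ϖ - ϖ) := Order.add_one_le_of_lt hlt
    push_cast at this ⊢
    exact this
  have hord2 : ord P (2 : B) = (e : ℕ∞) := by
    refine le_antisymm ?_ ((mem_pow_iff_le_ord P).mp h2)
    by_contra hlt
    push Not at hlt
    apply h2'
    rw [mem_pow_iff_le_ord]
    have : (e : ℕ∞) + 1 ≤ ord P (2 : B) := Order.add_one_le_of_lt hlt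
    push_cast at this ⊢
    exact this
  have hord2a : ord P (2 * (σ • ϖ - ϖ)) = ((e + i + 1 : ℕ) : ℕ∞) := by
    rw [ord_mul P hP, hord2, horda]
    push_cast
    ring
  have hb : σ • (σ • ϖ - ϖ) - (σ • ϖ - ϖ) ∈ P ^ (i + 1 + i) := smul_sub_mem_pow_add_of_mem_pow hσ ha
  have hlt : ord P (2 * (σ • ϖ - ϖ)) < ord P (σ • (σ • ϖ - ϖ) - (σ • ϖ - ϖ)) := by
    rw [hord2a]
    refine lt_of_lt_of_le ?_ ((mem_pow_iff_le_ord P).mp hb)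
    exact_mod_cast (by omega : e + i + 1 < i + 1 + i)
  have hord : ord P (σ ^ 2 • ϖ - ϖ) = ((e + i + 1 : ℕ) : ℕ∞) := by
    rw [sq_smul_sub_eq, add_comm, ord_add_eq_of_lt P hlt, hord2a]
  constructor
  · rw [mem_ramificationSubgroup_iff_smul_sub_mem hP hϖ hϖ2 hsq0, mem_pow_iff_le_ord, hord]
    exact_mod_cast (by omega : i + e + 1 ≤ e + i + 1)
  · intro hmem
    have h := (mem_ramificationSubgroup_iff_smul_sub_mem hP hϖ hϖ2 hsq0 (i + e + 1)).mp hmem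
    rw [mem_pow_iff_le_ord, hord] at h
    have h' : i + e + 1 + 1 ≤ e + i + 1 := by exact_mod_cast h
    omega

/-- **`G_i = 1` for `i > e = v_P(2)` in residue characteristic `2`** (Serre's Exercise IV.3(c),
`p = 2`): for a finite group acting faithfully with `2 ∈ P^e ∖ P^{e+1}`, `e ≥ 1`, every `G_i`
with `e < i` is trivial.  Indeed `G₁` is a `2`-group (Serre IV §2 Cor. 3), and for `σ ∈ G_i ∖
G_{i+1}` with `i > e` the exact form gives `σ^{2^k} ∈ G_{i+ke} ∖ G_{i+ke+1}` for all `k`, so no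
power `σ^{2^k}` is trivial.  [cite: SerreLocalFields1979, Ch. IV §2 Exercise 3 (c) (p. 71)] -/
theorem ramificationSubgroup_eq_bot_of_ord_two_lt [Finite G] [FaithfulSMul G B] (hP : P ≠ ⊥)
    {e : ℕ} (h2 : (2 : B) ∈ P ^ e) (h2' : (2 : B) ∉ P ^ (e + 1)) (he : 1 ≤ e) {i : ℕ}
    (hei : e < i) : P.ramificationSubgroup G i = ⊥ := by
  classical
  have hPtop : P ≠ ⊤ := Ideal.IsMaximal.ne_top inferInstance
  haveI : IsNoetherianRing B := inferInstance
  -- `G₁` is a `2`-group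
  have h2P : ((2 : ℕ) : B) ∈ P := by
    have : (2 : B) ∈ P ^ 1 := Ideal.pow_le_pow_right he h2
    rw [pow_one] at this
    exact_mod_cast this
  have hG1 : IsPGroup 2 (P.ramificationSubgroup G 1) :=
    Ideal.isPGroup_ramificationSubgroup_one P G hPtop h2P
  -- eventually trivial
  obtain ⟨N, hN⟩ := P.ramificationSubgroup_eventually_eq_bot_holds G hPtop
  rw [Subgroup.eq_bot_iff_forall]
  intro σ hσi
  by_contra hσ1
  -- the exact level `j ≥ i` of `σ`
  have hfin : lowerIndex P G σ ≠ ⊤ := lowerIndex_ne_top P (hN N le_rfl) hσ1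
  obtain ⟨m, hm⟩ := ENat.ne_top_iff_exists.mp hfin
  have hm1 : i + 1 ≤ m := by
    have := add_one_le_lowerIndex P hσi
    rw [← hm] at this
    exact_mod_cast this
  obtain ⟨j, rfl⟩ : ∃ j, m = j + 1 := ⟨m - 1, by omega⟩
  have hσj : σ ∈ P.ramificationSubgroup G j := (add_one_le_lowerIndex_iff P).mp (by rw [← hm]; rfl)
  have hσj' : σ ∉ P.ramificationSubgroup G (j + 1) := by
    intro h
    have := add_one_le_lowerIndex P h
    rw [← hm] at this
    have h' : j + 1 + 1 ≤ j + 1 := by exact_mod_cast this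
    omega
  have hij : i ≤ j := by omega
  -- induction: `σ^(2^k) ∈ G_{j+ke} ∖ G_{j+ke+1}`
  have key : ∀ k : ℕ, σ ^ (2 ^ k) ∈ P.ramificationSubgroup G (j + k * e) ∧
      σ ^ (2 ^ k) ∉ P.ramificationSubgroup G (j + k * e + 1) := by
    intro k
    induction k with
    | zero => simpa using ⟨hσj, hσj'⟩
    | succ k ih =>
      have h0 : σ ^ (2 ^ k) ∈ P.ramificationSubgroup G 0 :=
        P.ramificationSubgroup_antitone G (Nat.zero_le _) ih.1
      have hlt : e < j + k * e := by nlinarith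
      have h := sq_mem_and_sq_notMem_ramificationSubgroup_of_lt hP h0 ih.1 ih.2 h2 h2' hlt
      rw [← pow_mul, ← pow_succ] at h
      refine ⟨?_, ?_⟩
      · have e1 : j + k * e + e = j + (k + 1) * e := by ring
        rw [e1] at h; exact h.1
      · have e1 : j + k * e + e + 1 = j + (k + 1) * e + 1 := by ring
        rw [e1] at h; exact h.2
  -- but `σ` has order a power of `2`
  have hσ1mem : σ ∈ P.ramificationSubgroup G 1 :=
    P.ramificationSubgroup_antitone G (by omega : 1 ≤ j) hσj
  obtain ⟨k, hk⟩ := hG1 ⟨σ, hσ1mem⟩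
  have hk' : σ ^ (2 ^ k) = 1 := by
    have := congrArg Subtype.val hk
    simpa using this
  exact (key k).2 (by rw [hk']; exact Subgroup.one_mem _)

/-- `i_G(ι) ≤ e + 1` for `ι ≠ 1` when `2 ∈ P^e ∖ P^{e+1}`, `e ≥ 1` (from (c): `ι ∉ G_{e+1} = 1`).
[cite: SerreLocalFields1979, Ch. IV §2 Exercise 3 (c) (p. 71)] -/
theorem lowerIndex_le_of_ord_two [Finite G] [FaithfulSMul G B] (hP : P ≠ ⊥)
    {e : ℕ} (h2 : (2 : B) ∈ P ^ e) (h2' : (2 : B) ∉ P ^ (e + 1)) (he : 1 ≤ e) {ι : G}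
    (hι : ι ≠ 1) : lowerIndex P G ι ≤ (e + 1 : ℕ) := by
  have hbot := ramificationSubgroup_eq_bot_of_ord_two_lt (G := G) hP h2 h2' he (Nat.lt_succ_self e)
  by_contra hlt
  push Not at hlt
  have hmem : ι ∈ P.ramificationSubgroup G (e + 1) := by
    rw [← add_one_le_lowerIndex_iff P]
    have : ((e + 1 : ℕ) : ℕ∞) + 1 ≤ lowerIndex P G ι := Order.add_one_le_of_lt hlt
    exact_mod_cast this
  rw [hbot, Subgroup.mem_bot] at hmem
  exact hι hmem

/-! ### Serre's Prop. IV.3 through a quotient with kernel `{1, z}` -/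

section Quotient

variable (R : Type*) {K L : Type*} [CommRing R] [IsDedekindDomain R] [Field K] [Field L]
  [Algebra R K] [IsFractionRing R K] [Algebra R L] [Algebra K L] [IsScalarTower R K L]
  [FiniteDimensional K L] [IsGalois K L] (E : IntermediateField K L) [Normal K E]
  (𝔓 : Ideal (integralClosure R L)) [𝔓.IsMaximal]
  [Algebra.IsSeparable (R ⧸ 𝔓.under R) (integralClosure R L ⧸ 𝔓)]

set_option synthInstance.maxHeartbeats 400000 in
/-- **`2 · i_Q(s|_E) = i_G(s) + i_G(sz)` for a quotient with kernel `{1, z}`.**  `R` Dedekind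
with fraction field `K`, `L/K` finite Galois, `E/K` a normal subextension with
`ker (Gal(L/K) → Gal(E/K)) = {1, z}`, `z ≠ 1` in the inertia group `G₀` of the maximal ideal `𝔓`
of `S_L` (separable residue extension), `𝔓_E = 𝔓 ∩ E`.  Then for every `s ∈ G₀ ∖ {1, z}`,
`2 · i_{Gal(E/K)}(s|_E) = i_{Gal(L/K)}(s) + i_{Gal(L/K)}(sz)`: Serre's Prop. IV.3
`e' · i_{G/H}(σ) = Σ_{t ∈ H} i_G(st)` (`IndexFormula_holds`) with `e' = #H₀ = #{1, z} = 2`.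
[cite: SerreLocalFields1979, Ch. IV §1 Prop. 3 (p. 63)] -/
theorem two_mul_lowerIndex_restrictNormalHom_eq {z : L ≃ₐ[K] L} (hz1 : z ≠ 1)
    (hker : ∀ σ : L ≃ₐ[K] L, AlgEquiv.restrictNormalHom E σ = 1 ↔ σ = 1 ∨ σ = z)
    (hz0 : z ∈ 𝔓.ramificationSubgroup (L ≃ₐ[K] L) 0)
    {s : L ≃ₐ[K] L} (hs0 : s ∈ 𝔓.ramificationSubgroup (L ≃ₐ[K] L) 0) (hs1 : s ≠ 1) (hsz : s ≠ z) :
    (2 : ℕ∞) * lowerIndex (𝔓.comap (E.integralClosureInclusion R)) (E ≃ₐ[K] E)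
        (AlgEquiv.restrictNormalHom E s) =
      lowerIndex 𝔓 (L ≃ₐ[K] L) s + lowerIndex 𝔓 (L ≃ₐ[K] L) (s * z) := by
  classical
  haveI : IsFractionRing (integralClosure R L) L :=
    integralClosure.isFractionRing_of_finite_extension K L
  set π : (L ≃ₐ[K] L) →* (E ≃ₐ[K] E) := AlgEquiv.restrictNormalHom E with hπ
  have h3 : IndexFormula 𝔓 (𝔓.comap (E.integralClosureInclusion R)) π := IndexFormula_holds R E 𝔓
  have hsker : s ∉ π.ker := by
    intro h
    rcases (hker s).mp (MonoidHom.mem_ker.mp h) with h1 | h1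
    · exact hs1 h1
    · exact hsz h1
  have key := h3 s hs0 hsker
  -- the kernel `{1, z}` as a two-element type
  have hzker : z ∈ π.ker := MonoidHom.mem_ker.mpr ((hker z).mpr (Or.inr rfl))
  have hkerset : ∀ t : π.ker, (t : L ≃ₐ[K] L) = 1 ∨ (t : L ≃ₐ[K] L) = z := fun t ↦
    (hker t).mp (MonoidHom.mem_ker.mp t.2)
  set k1 : π.ker := ⟨1, Subgroup.one_mem _⟩ with hk1
  set kz : π.ker := ⟨z, hzker⟩ with hkz
  have hne : k1 ≠ kz := fun h ↦ hz1 (congrArg Subtype.val h).symm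
  have huniv : (Finset.univ : Finset π.ker) = {k1, kz} := by
    ext t
    simp only [Finset.mem_univ, Finset.mem_insert, Finset.mem_singleton, true_iff]
    rcases hkerset t with h | h
    · exact Or.inl (Subtype.ext h)
    · exact Or.inr (Subtype.ext h)
  -- `#(ker π)_0 = 2`
  have hker0 : Nat.card (𝔓.ramificationSubgroup π.ker 0) = 2 := by
    have htop : 𝔓.ramificationSubgroup π.ker 0 = ⊤ := by
      ext t
      simp only [Subgroup.mem_top, iff_true]
      rw [mem_ramificationSubgroup_subgroup_iff]
      rcases hkerset t with h | h
      · rw [h]; exact Subgroup.one_mem _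
      · rw [h]; exact hz0
    rw [htop, Subgroup.card_top, Nat.card_eq_fintype_card, ← Finset.card_univ, huniv,
      Finset.card_pair hne]
  have hsum : ∑ᶠ t : π.ker, lowerIndex 𝔓 (L ≃ₐ[K] L) (s * t) =
      lowerIndex 𝔓 (L ≃ₐ[K] L) s + lowerIndex 𝔓 (L ≃ₐ[K] L) (s * z) := by
    rw [finsum_eq_sum_of_fintype, huniv, Finset.sum_pair hne]
    simp [hk1, hkz]
  rw [hsum, hker0] at key
  exact_mod_cast key

set_option synthInstance.maxHeartbeats 400000 in
/-- **`i_G(σ) = i_Q(σ|_E)` for a square root `σ` of the central involution.**  In the setting of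
`two_mul_lowerIndex_restrictNormalHom_eq` with kernel `{1, ι}`: if `σ ∈ G₀`, `σ ∉ {1, ι}`,
`σ² = ι` and `σ⁴ = 1`, then `i_{Gal(L/K)}(σ) = i_{Gal(E/K)}(σ|_E)`, because `σι = σ³ = σ⁻¹`
has the same index as `σ` (Serre, p. 62).  For the `3`-division field of an elliptic curve above
`2` (`E = K(x(E[3]))`, `ι = [-1]`) every wild element outside `{1, ι}` is such a `σ`.
[cite: SerreLocalFields1979, Ch. IV §1 Prop. 3 (p. 63) and p. 62 (i_G(s⁻¹) = i_G(s))] -/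
theorem lowerIndex_eq_lowerIndex_restrictNormalHom_of_sq_eq {ι : L ≃ₐ[K] L} (hι1 : ι ≠ 1)
    (hker : ∀ σ : L ≃ₐ[K] L, AlgEquiv.restrictNormalHom E σ = 1 ↔ σ = 1 ∨ σ = ι)
    {σ : L ≃ₐ[K] L} (hσ0 : σ ∈ 𝔓.ramificationSubgroup (L ≃ₐ[K] L) 0)
    (hσ1 : σ ≠ 1) (hσι : σ ≠ ι) (hsq : σ ^ 2 = ι) (hσ4 : σ ^ 4 = 1) :
    lowerIndex 𝔓 (L ≃ₐ[K] L) σ =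
      lowerIndex (𝔓.comap (E.integralClosureInclusion R)) (E ≃ₐ[K] E)
        (AlgEquiv.restrictNormalHom E σ) := by
  haveI : IsFractionRing (integralClosure R L) L :=
    integralClosure.isFractionRing_of_finite_extension K L
  haveI : FaithfulSMul (L ≃ₐ[K] L) (integralClosure R L) :=
    (IsGaloisGroup.of_isFractionRing (L ≃ₐ[K] L) R (integralClosure R L) K L).faithful
  haveI : IsNoetherianRing (integralClosure R L) := integralClosure.isNoetherianRing (K := K) L
  obtain ⟨N, hN⟩ := Ideal.ramificationSubgroup_eventually_eq_bot_holds 𝔓 (L ≃ₐ[K] L)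
    (Ideal.IsMaximal.ne_top inferInstance)
  have hι0 : ι ∈ 𝔓.ramificationSubgroup (L ≃ₐ[K] L) 0 := by
    rw [← hsq]; exact Subgroup.pow_mem _ hσ0 2
  have key := two_mul_lowerIndex_restrictNormalHom_eq R E 𝔓 hι1 hker hι0 hσ0 hσ1 hσι
  -- `σ ι = σ⁻¹`
  have hσι' : σ * ι = σ⁻¹ := by
    rw [← hsq, ← pow_succ', eq_inv_iff_mul_eq_one, ← pow_succ, hσ4]
  rw [hσι', lowerIndex_inv] at key
  -- `2 · i_Q = i_G + i_G`, all finite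
  have hfin : lowerIndex 𝔓 (L ≃ₐ[K] L) σ ≠ ⊤ := lowerIndex_ne_top 𝔓 (hN N le_rfl) hσ1
  obtain ⟨m, hm⟩ := ENat.ne_top_iff_exists.mp hfin
  rw [← hm] at key ⊢
  have hfinQ : lowerIndex (𝔓.comap (E.integralClosureInclusion R)) (E ≃ₐ[K] E)
      (AlgEquiv.restrictNormalHom E σ) ≠ ⊤ := by
    intro htop
    rw [htop, ENat.mul_top (by norm_num)] at key
    exact ENat.coe_ne_top (m + m) (by push_cast; exact key.symm)
  obtain ⟨n, hn⟩ := ENat.ne_top_iff_exists.mp hfinQ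
  rw [← hn] at key ⊢
  have h2 : (2 : ℕ) * n = m + m := by exact_mod_cast key
  have : m = n := by omega
  rw [this]

set_option synthInstance.maxHeartbeats 400000 in
/-- **The central involution lies in `G₆`** when a square root `σ` of it restricts into `Q₃` and
`2 ∈ 𝔓^e`, `e ≥ 3`: `i_G(σ) = i_Q(σ|_E) ≥ 4`, so `σ ∈ G₃` and `ι = σ² ∈ G_{min(6, 3 + e)} = G₆`
(`sq_mem_ramificationSubgroup_min`).  For the `3`-division field of an elliptic curve above `2`
this bounds the break `b = i_G(ι) - 1` of `K(E[3])/K(x(E[3]))` below by `6` as soon as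
`Gal(K(x(E[3]))/K)` has an element of index `≥ 4` at `𝔓`.
[cite: SerreLocalFields1979, Ch. IV §1 Prop. 3 and §2 Exercise 3 (a)] -/
theorem mem_ramificationSubgroup_six_of_sq_eq {ι : L ≃ₐ[K] L} (hι1 : ι ≠ 1)
    (hker : ∀ σ : L ≃ₐ[K] L, AlgEquiv.restrictNormalHom E σ = 1 ↔ σ = 1 ∨ σ = ι)
    {σ : L ≃ₐ[K] L} (hσ0 : σ ∈ 𝔓.ramificationSubgroup (L ≃ₐ[K] L) 0)
    (hσ1 : σ ≠ 1) (hσι : σ ≠ ι) (hsq : σ ^ 2 = ι) (hσ4 : σ ^ 4 = 1)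
    (h3 : AlgEquiv.restrictNormalHom E σ ∈
      (𝔓.comap (E.integralClosureInclusion R)).ramificationSubgroup (E ≃ₐ[K] E) 3)
    {e : ℕ} (h2 : (2 : integralClosure R L) ∈ 𝔓 ^ e) (he : 3 ≤ e) (hP : 𝔓 ≠ ⊥)
    [Finite (integralClosure R L ⧸ 𝔓)] :
    ι ∈ 𝔓.ramificationSubgroup (L ≃ₐ[K] L) 6 := by
  haveI : IsDedekindDomain (integralClosure R L) := integralClosure.isDedekindDomain R K L
  have hidx := lowerIndex_eq_lowerIndex_restrictNormalHom_of_sq_eq R E 𝔓 hι1 hker hσ0 hσ1 hσι hsq hσ4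
  have hσ3 : σ ∈ 𝔓.ramificationSubgroup (L ≃ₐ[K] L) 3 := by
    rw [← add_one_le_lowerIndex_iff 𝔓, hidx]
    exact add_one_le_lowerIndex _ h3
  have h := sq_mem_ramificationSubgroup_min hP hσ0 hσ3 h2
  rw [hsq, show min (2 * 3) (3 + e) = 6 by omega] at h
  exact h

set_option synthInstance.maxHeartbeats 400000 in
/-- **The indices of a four-group from its three quadratic quotients.**  `R` Dedekind with
fraction field `K`, `L/K` finite Galois, `𝔓` a maximal ideal of `S_L` (separable residue
extension), `z₁, z₂ ∈ G₀` commuting involutions with `z₁, z₂, z₃ = z₁z₂` pairwise distinct and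
`≠ 1`, and for `j = 1, 2, 3` a normal subextension `E_j/K` with
`ker (Gal(L/K) → Gal(E_j/K)) = {1, z_j}`.  If the restriction of `z₂` (resp. `z₁`, `z₁`) to
`E₁` (resp. `E₂`, `E₃`) has index `n₁` (resp. `n₂`, `n₃`) at `𝔓 ∩ E_j`, then
**`i_G(z₁) + n₁ = n₂ + n₃`, `i_G(z₂) + n₂ = n₁ + n₃`, `i_G(z₃) + n₃ = n₁ + n₂`**
(Prop. IV.3 for the three quotients: `2n₁ = i(z₂) + i(z₃)`, `2n₂ = i(z₁) + i(z₃)`,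
`2n₃ = i(z₁) + i(z₂)`).  So the lower filtration of a biquadratic extension at a totally
ramified prime is determined by the breaks of its three quadratic subextensions — e.g. breaks
`(1, 2, 2)`, indices `(2, 3, 3)`, give `i(z₁) = 4`, `i(z₂) = i(z₃) = 2`: `#G₁ = 4`,
`#G₂ = #G₃ = 2`, `#G₄ = 1`.  [cite: SerreLocalFields1979, Ch. IV §1 Prop. 3 (p. 63)] -/
theorem lowerIndex_add_eq_of_biquadratic
    (E₁ E₂ E₃ : IntermediateField K L) [Normal K E₁] [Normal K E₂] [Normal K E₃]
    {z₁ z₂ : L ≃ₐ[K] L} (h11 : z₁ * z₁ = 1) (h22 : z₂ * z₂ = 1) (hcomm : z₁ * z₂ = z₂ * z₁)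
    (hz₁ : z₁ ≠ 1) (hz₂ : z₂ ≠ 1) (h12 : z₁ ≠ z₂)
    (hz₁0 : z₁ ∈ 𝔓.ramificationSubgroup (L ≃ₐ[K] L) 0)
    (hz₂0 : z₂ ∈ 𝔓.ramificationSubgroup (L ≃ₐ[K] L) 0)
    (hker₁ : ∀ σ : L ≃ₐ[K] L, AlgEquiv.restrictNormalHom E₁ σ = 1 ↔ σ = 1 ∨ σ = z₁)
    (hker₂ : ∀ σ : L ≃ₐ[K] L, AlgEquiv.restrictNormalHom E₂ σ = 1 ↔ σ = 1 ∨ σ = z₂)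
    (hker₃ : ∀ σ : L ≃ₐ[K] L, AlgEquiv.restrictNormalHom E₃ σ = 1 ↔ σ = 1 ∨ σ = z₁ * z₂)
    {n₁ n₂ n₃ : ℕ}
    (hn₁ : lowerIndex (𝔓.comap (E₁.integralClosureInclusion R)) (E₁ ≃ₐ[K] E₁)
      (AlgEquiv.restrictNormalHom E₁ z₂) = n₁)
    (hn₂ : lowerIndex (𝔓.comap (E₂.integralClosureInclusion R)) (E₂ ≃ₐ[K] E₂)
      (AlgEquiv.restrictNormalHom E₂ z₁) = n₂)
    (hn₃ : lowerIndex (𝔓.comap (E₃.integralClosureInclusion R)) (E₃ ≃ₐ[K] E₃)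
      (AlgEquiv.restrictNormalHom E₃ z₁) = n₃) :
    lowerIndex 𝔓 (L ≃ₐ[K] L) z₁ + n₁ = (n₂ + n₃ : ℕ) ∧
      lowerIndex 𝔓 (L ≃ₐ[K] L) z₂ + n₂ = (n₁ + n₃ : ℕ) ∧
      lowerIndex 𝔓 (L ≃ₐ[K] L) (z₁ * z₂) + n₃ = (n₁ + n₂ : ℕ) := by
  haveI : IsFractionRing (integralClosure R L) L :=
    integralClosure.isFractionRing_of_finite_extension K L
  haveI : FaithfulSMul (L ≃ₐ[K] L) (integralClosure R L) :=
    (IsGaloisGroup.of_isFractionRing (L ≃ₐ[K] L) R (integralClosure R L) K L).faithful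
  haveI : IsNoetherianRing (integralClosure R L) := integralClosure.isNoetherianRing (K := K) L
  obtain ⟨N, hN⟩ := Ideal.ramificationSubgroup_eventually_eq_bot_holds 𝔓 (L ≃ₐ[K] L)
    (Ideal.IsMaximal.ne_top inferInstance)
  -- group identities
  have hz₃ : z₁ * z₂ ≠ 1 := by
    intro h
    apply h12
    calc z₁ = z₁ * (z₂ * z₂) := by rw [h22, mul_one]
      _ = z₁ * z₂ * z₂ := by rw [mul_assoc]
      _ = z₂ := by rw [h, one_mul]
  have h13 : z₁ ≠ z₁ * z₂ := by
    intro h; apply hz₂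
    have : z₁ * 1 = z₁ * z₂ := by rw [mul_one]; exact h
    exact (mul_left_cancel this).symm
  have h23 : z₂ ≠ z₁ * z₂ := by
    intro h; apply hz₁
    have : 1 * z₂ = z₁ * z₂ := by rw [one_mul]; exact h
    exact (mul_right_cancel this).symm
  have hz₃0 : z₁ * z₂ ∈ 𝔓.ramificationSubgroup (L ≃ₐ[K] L) 0 := Subgroup.mul_mem _ hz₁0 hz₂0
  have e21 : z₂ * z₁ = z₁ * z₂ := hcomm.symm
  have e13 : z₁ * (z₁ * z₂) = z₂ := by rw [← mul_assoc, h11, one_mul]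
  -- the three index formulas
  have f₁ := two_mul_lowerIndex_restrictNormalHom_eq R E₁ 𝔓 hz₁ hker₁ hz₁0 hz₂0 hz₂ (Ne.symm h12)
  have f₂ := two_mul_lowerIndex_restrictNormalHom_eq R E₂ 𝔓 hz₂ hker₂ hz₂0 hz₁0 hz₁ h12
  have f₃ := two_mul_lowerIndex_restrictNormalHom_eq R E₃ 𝔓 hz₃ hker₃ hz₃0 hz₁0 hz₁ h13
  rw [hn₁, e21] at f₁
  rw [hn₂] at f₂
  rw [hn₃, e13] at f₃
  -- finiteness
  obtain ⟨a, ha⟩ := ENat.ne_top_iff_exists.mp (lowerIndex_ne_top 𝔓 (hN N le_rfl) hz₁)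
  obtain ⟨b, hb⟩ := ENat.ne_top_iff_exists.mp (lowerIndex_ne_top 𝔓 (hN N le_rfl) hz₂)
  obtain ⟨c, hc⟩ := ENat.ne_top_iff_exists.mp (lowerIndex_ne_top 𝔓 (hN N le_rfl) hz₃)
  rw [← hb, ← hc] at f₁
  rw [← ha, ← hc] at f₂
  rw [← ha, ← hb] at f₃
  rw [← ha, ← hb, ← hc]
  have g₁ : 2 * n₁ = b + c := by exact_mod_cast f₁
  have g₂ : 2 * n₂ = a + c := by exact_mod_cast f₂
  have g₃ : 2 * n₃ = a + b := by exact_mod_cast f₃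
  refine ⟨?_, ?_, ?_⟩
  · exact_mod_cast (show a + n₁ = n₂ + n₃ by omega)
  · exact_mod_cast (show b + n₂ = n₁ + n₃ by omega)
  · exact_mod_cast (show c + n₃ = n₁ + n₂ by omega)

end Quotient

end Literature.NumberTheory.GaloisRepresentations
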